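import Summits.QuantumFields.YangMills.Theorems.UnitScaleTiltMinimiserStabilityRegPrOfHalvingExistence
import Summits.QuantumFields.YangMills.Theorems.UnitScaleTiltHistoryTailOneSupplierKinematic
import Summits.QuantumFields.YangMills.Theorems.AlphaInputsT3ACv3RecordXChi
import Summits.QuantumFields.YangMills.Theorems.UnitScaleTiltFluctuationComparisonRegPrGlobalSlackKernelLegDisplayProfile
import Summits.QuantumFields.YangMills.Theorems.UnitScaleTiltFluctuationComparisonRegPrGlobalSlackKernelLegDisplayProfileLow
import Summits.QuantumFields.YangMills.Theses.UnitScaleTilt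
import HarnessLib

/-!
# `UnitScaleTiltYM3OfFiveInputsProfile` — THE RUNG-LEVEL CERTIFICATE WITH THE K1a DISPLAY READ AT THE DOOR'S PROFILE: `YM3TorusSU2` ⇐ {⟨v10 H⟩, ⟨v10 EX⟩, kinematic lift,
# (O″χ) rows, the SIX-row per-run display `K1aLegRowsDisplayChiAt` at some `p₁ ≥ p₀ + r₀`} (the (R4)-low variant follows in an append once its olean is on the farm)
# (route `UnitScaleTilt`; cruxes stmt-QuantumFields-19200 / 20520 / 19936; width seat ym-ust-20520-w1 g2; count-neutral; an import-LEAF — nothing may import this file;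
# YM₃ on the 3-torus is ladder rung R3 (RECORD†), NOT the Clay problem)

WHY.  ★ym-ust-20520-w3 g2's certificate `YM3OfFiveInputs.ym3TorusSU2_of_fiveInputs` (p593153, OWNER-ENDORSED 01:20:00Z; NOT imported here — it stays an import-leaf; its
hypothesis texts are COPIED verbatim and its 2′χ step re-derived inline) reads the deciding crux's K1a input as ★w1 g0's SEVEN-row
display `K1aLegRowsDisplayChi` at the record's profile `p₀`.  Under ★r1 g5's higher-profile door the display of record is the SIX-row `K1aLegRowsDisplayChiAt L 𝔠 a₀ a₁ a p₁` at a
supplier-chosen `p₁ ≥ 𝔠.p₀ + 𝔠.r₀` ((F^Λ) a theorem there: `…KernelLegResidualFarProfile`, p591849; composition `…KernelLegDisplayProfile`, p592610), and (R4)'s new-level clause is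
`bound28` (`…KernelLegDisplayProfileLow`, p593261).  This file is the certificate's twin in that currency — same four other inputs VERBATIM, same `Theses.UnitScaleTilt.closes` term,
h201 := `InteriorExcision.regPrIntL_of_T8_recChi_k1aLegRowsDisplayChiAt_allL` (T8 ⇐ {H, EX} by ★w4-20520's `AttainmentOfExistence.thm1In8GlobalMin_of_halvingStep_of_existence`).
CONDITIONAL CERTIFICATE; proves nothing unconditionally; the five hypotheses are the open analytic content of the cell (H, EX = 19200 v10's registered stubs; the kinematic lift and
the (O″χ) rows = 2′χ's suppliers; the display = NODE-O depth).  Registry untouched (`--supports stmt-QuantumFields-20520 --as helper`).  RECORD† rung R3, not Clay, not d = 4, not a gap.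

References: T. Bałaban, CMP 102 (1985) 277–309 [Balaban1985Variational] (Thm 1 (8) p.279, Prop. 7 p.299, Sect. F p.300, Prop. 8 p.304); CMP 102 (1985) 255–275 [Balaban1985UV3]
((7) p.257, (27)–(28) p.263, (41)–(47) pp.266–267, (57) p.270, (61)–(63) pp.271–272, Thm 2 p.272); C. King, CMP 102 (1986) 649–677 [King1986] (Thm 3.4 (3.9) p.656, Prop. 3.6 (3.56)
p.662); CMP 109 (1987) 249–301 [Balaban1987RG1] ((0.4) p.253).
-/

set_option autoImplicit false

noncomputable section

namespace Summit.QuantumFields.YangMills.Theorems.YM3OfFiveInputsProfile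

open MeasureTheory Set
open scoped Matrix.Norms.L2Operator
open Literature.MathematicalPhysics.QuantumFieldTheory.Balaban1983to89
open Literature.MathematicalPhysics.QuantumFieldTheory.Balaban1983to89.T3ContinuumYM3Torus
open Literature.MathematicalPhysics.QuantumFieldTheory.Balaban1983to89.T3UnitLawDensityEML (ℰp)
open Literature.MathematicalPhysics.QuantumFieldTheory.Balaban1983to89.T3PrintedRegularMinimiser
open Literature.MathematicalPhysics.QuantumFieldTheory.Balaban1983to89.T3PrintedMinimiserExistence (Thm1GlobalMinAt)
open Literature.MathematicalPhysics.QuantumFieldTheory.Balaban1983to89.T3LowerAlongMinimisersSplit (MinimisersIn8At)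
open Literature.MathematicalPhysics.QuantumFieldTheory.Balaban1983to89.T3ConstrainedMinimiser (fibre)
open Literature.MathematicalPhysics.QuantumFieldTheory.Balaban1983to89.T3Thm1Carrier (famX Idx)
open Literature.MathematicalPhysics.QuantumFieldTheory.Balaban1983to89.ExpMeanLog (deltaSU)
open Literature.MathematicalPhysics.QuantumFieldTheory.Balaban1983to89.B10Eq38TorusDomains (plaqsIn toFine)
open Literature.MathematicalPhysics.QuantumFieldTheory.Balaban1983to89.B10Eq42TorusConstraint (bondsIn)
open Literature.MathematicalPhysics.QuantumFieldTheory.Balaban1985CMP102.Setting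
open Summit.QuantumFields.Balaban3D.Carriers
open Summit.QuantumFields.Balaban3D.Proofs.Primitives
open Summit.QuantumFields.Balaban3D.Proofs.Thresholds (Q0)
open B7Prop2Explicit (C0)
open Summit.QuantumFields.YangMills.Theorems.GlobalSlackKernelLeg (K1aLegRowsDisplayChiAt)

/-- ★★★ **THE RUNG FROM FIVE DISPLAYED INPUTS, THE K1a DISPLAY AT THE DOOR'S PROFILE** — `YM3TorusSU2` from ⟨v10 `stub_halvingStep`⟩, ⟨v10 `stub_existenceMinimalOrbit`⟩, the
kinematic lift ∀ odd `L > 1`, the (O″χ) rows ∀ odd `L > 1`, and — for every odd `L > 1`, every record and [7]-constants — a rate `a ∈ (0,1)`, a profile `p₁ ≥ 𝔠.p₀ + 𝔠.r₀` and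
the SIX-row per-run display `K1aLegRowsDisplayChiAt L 𝔠 a₀ a₁ a p₁` ((R1) (R2′) (N) (M1) (R4)@p₁ (R5)@p₁; (F^Λ) is NOT asked) — through `Theses.UnitScaleTilt.closes` with
h200 := ★w4-20520's `MinimiserStabilityRegPr_of_halvingStep_of_existence`, h201 := `InteriorExcision.regPrIntL_of_T8_recChi_k1aLegRowsDisplayChiAt_allL` at T8 := w4's {H,EX} theorem (2′χ by ★w3 g2's
`recChi_of_halving_exist_kinematicLift_dataRows`), hK2 := ★w5-19936's `historyTailL_of_thm1In8_kinematicLift_dataRows_allL`.  Nothing is asserted.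
[cite: Balaban1985Variational, Thm 1 (8) p.279, Prop. 7 p.299, Sect. F p.300, Prop. 8 p.304; Balaban1985UV3, (41)-(47) pp.266-267, (57) p.270, (61)-(63) pp.271-272, Thm 2 p.272; King1986, Thm 3.4 (3.9) p.656, Prop. 3.6 (3.56) p.662; Balaban1987RG1, (0.4) p.253] -/
theorem ym3TorusSU2_of_fiveInputs_displayAt
    (hH : ∀ (L : ℕ), 1 < L → ∃ B₃ : ℝ, 4 < B₃ ∧ ∃ a₅ : ℝ, 0 < a₅ ∧
      ∀ (i : Idx L) (ε₀ ε₁ : ℝ), 0 < ε₁ → ∀ (V : (famX L i).Bdry) (U : (famX L i).Cfg), (famX L i).Reg7 ε₁ V → (famX L i).InU ε₀ U →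
        (famX L i).InB V U → (famX L i).IsCritical V U → ε₀ ≤ a₅ → (famX L i).InU (max (B₃ * ε₁) (ε₀ / 2)) U)
    (hEX : ∀ (L : ℕ), 1 < L → ∀ (B₃ : ℝ), 4 < B₃ → ∃ a₁' O₁ : ℝ, 0 < a₁' ∧ 1 ≤ O₁ ∧
      ∀ (F : T3Family), F.L = L → ∀ (n K : ℕ) (hnK : n < K) (ε₁ : ℝ), 0 < ε₁ →
        ∀ V : GaugeField (F.P n) 0 (Matrix.specialUnitaryGroup (Fin 2) ℂ), PlaqSmall ε₁ V →
          ∀ U₀ : GaugeField (F.P K) 0 (Matrix.specialUnitaryGroup (Fin 2) ℂ), RegPr F n K ((L : ℝ) ^ 3 * B₃ * ε₁) U₀ → U₀ ∈ fibre F ℰp n K hnK.le V →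
            ε₁ ≤ a₁' → ∃ U ∈ regFibrePr F n K hnK.le (O₁ * (L : ℝ) ^ 3 * B₃ * ε₁) V,
              IsMinOn (fun W : GaugeField (F.P K) 0 (Matrix.specialUnitaryGroup (Fin 2) ℂ) => wilsonAction4 W)
                (regFibrePr F n K hnK.le (O₁ * (L : ℝ) ^ 3 * B₃ * ε₁) V) U)
    (hkin : ∀ L : ℕ, Odd L → 1 < L → ∃ (B_K η : ℝ), 0 < η ∧
      ∀ (F : T3Family) (_hF : F.L = L) (K : ℕ), ∀ (k : ℕ), k ≤ K → ∀ (Ω : Set (Site (F.P K) 0)), (∀ w : Site (F.P K) 0, w ∈ Ω ↔ toFine k (coarsen k w) ∈ Ω) →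
        ∀ (ε : ℝ), 0 < ε → ε ≤ η → ∀ (W : GaugeField (F.P K) k (Matrix.specialUnitaryGroup (Fin 2) ℂ)), PlaqSmallOn (↑(plaqsIn k Ω)) ε W →
          ∃ U : GaugeField (F.P K) 0 (Matrix.specialUnitaryGroup (Fin 2) ℂ),
            (∀ b : PBond (F.P K) k, b ∈ bondsIn k Ω → Averaging.iter (fun i => BlockAveraging.blockAvg (P := F.P K) (j := i) ℰp) k U b = W b) ∧
            ∀ q : Plaq (F.P K) 0, q ∈ plaqsIn 0 Ω → GaugeGroup.dist1 (GaugeField.plaqHol U q) < B_K * ε * (((F.L : ℝ) ^ k)⁻¹) ^ 2)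
    (hO : ∀ L : ℕ, Odd L → 1 < L → ∃ (B₀ A₀ A₁ : ℝ), 0 < A₀ ∧ 0 < A₁ ∧
      ∀ (B a₀ a₁ : ℝ), B₀ ≤ B → 1 ≤ 2 * B → 0 < a₀ → a₀ ≤ A₀ → 0 < a₁ → a₁ ≤ A₁ → B * a₁ ≤ a₀ →
        (143 * ((((3 + 4 : ℕ) : ℝ)) ^ 2 / 4) ^ 2) * (2 * (B * a₁)) ≤ 1 / 3 →
        2 * (2 * (B * a₁)) ≤ 2 * deltaSU (Fin 2) / (((3 + 4) * L : ℕ) : ℝ) ^ 2 →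
        Thm1GlobalMinAt L a₀ a₁ B →
        ∃ (b₁ p₁ : ℝ), ∀ (b₀ p₀ : ℝ), b₁ ≤ b₀ → p₁ ≤ p₀ →
          ∃ 𝔠 : AlphaConsts L (suGroupModel 2).N, 𝔠.b₀ = b₀ ∧ 𝔠.p₀ = p₀ ∧ 𝔠.B₃ = B ∧
            4 * 𝔠.B₃ * (L : ℝ) ^ 2 * avgWindowFactor L ≤ 𝔠.C68 ∧
            Real.exp (𝔠.p₀ - 1) ≤ 3 * C0 3 * 𝔠.C68 * (𝔠.b₀ * Q0 𝔠.p₀) ∧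
            (𝔠.b₀ * Q0 𝔠.p₀) * (2 * (L : ℝ) ^ 2 * avgWindowFactor L) ^ 2 ≤ 3 * C0 3 * 𝔠.C68 * a₁ ^ 2 ∧
            7 * L + 3 ≤ 𝔠.M₁ ∧
            ∀ (F : T3Family) (hF : F.L = L),
              (∀ (γ : ℝ) (hγ : 0 < γ) (hγ1 : γ ≤ (min (hF ▸ 𝔠).gamma0 1) ^ 2) (K : ℕ),
                (∃ Ut : (k : ℕ) → GaugeField (F.P K) k (Matrix.specialUnitaryGroup (Fin 2) ℂ) →
                    GaugeField (F.P K) 0 (Matrix.specialUnitaryGroup (Fin 2) ℂ),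
                  AlphaInputsT3AC.TrivMinimiserRowsT3 F (hF ▸ 𝔠) γ hγ hγ1 a₀ a₁ K Ut) →
                ∃ Ut : (k : ℕ) → GaugeField (F.P K) k (Matrix.specialUnitaryGroup (Fin 2) ℂ) →
                    GaugeField (F.P K) 0 (Matrix.specialUnitaryGroup (Fin 2) ℂ),
                  AlphaInputsT3AC.TrivMinimiserRowsT3 F (hF ▸ 𝔠) γ hγ hγ1 a₀ a₁ K Ut ∧
                    AlphaInputsT3AC.DataRowsT3XChi F (hF ▸ 𝔠) γ hγ hγ1 K Ut))
    (hDisp : ∀ (L : ℕ), Odd L → 1 < L → ∀ (𝔠 : AlphaConsts L (suGroupModel 2).N) (a₀ a₁ : ℝ), 0 < a₀ → 0 < a₁ → 𝔠.B₃ * a₁ ≤ a₀ →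
      ∃ a : ℝ, 0 < a ∧ a < 1 ∧ ∃ p₁ : ℝ, 𝔠.p₀ + 𝔠.r₀ ≤ p₁ ∧ K1aLegRowsDisplayChiAt L 𝔠 a₀ a₁ a p₁) :
    Literature.MathematicalPhysics.QuantumFieldTheory.Balaban1983to89.T3YM3TorusStatement.YM3TorusSU2 :=
  have hT8 := AttainmentOfExistence.thm1In8GlobalMin_of_halvingStep_of_existence hH hEX
  -- 2′χ at every odd block size from {H, EX}, the kinematic lift and the (O″χ) rows (★w3 g2's `recChi_of_halving_exist_kinematicLift_dataRows`, inlined to stay off its import-leaf)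
  have h2 : ∀ L : ℕ, Odd L → 1 < L → AlphaInputsT3ACv3RecChi L := fun L hLo hL => by
    obtain ⟨a₀, a₁, B₃, ha₀, ha₁, hB₃, hT, -⟩ := hT8 L hLo hL
    obtain ⟨B_K, η, hη, hk⟩ := hkin L hLo hL
    obtain ⟨B₀, A₀, A₁, hA₀, hA₁, hO'⟩ := hO L hLo hL
    exact alphaInputsT3ACv3RecChi_of_pinnedPartsRecFLChi
      (HistoryTailOneSupplier.pinnedPartsT3ACRecFLChi_of_thm1_kinematicLift_dataRows hL ⟨a₀, a₁, B₃, ha₀, ha₁, hB₃, hT⟩ hη hk hA₀ hA₁ hO')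
  Summit.QuantumFields.YangMills.Theses.UnitScaleTilt.closes
    (AttainmentOfExistence.MinimiserStabilityRegPr_of_halvingStep_of_existence hH hEX)
    (InteriorExcision.regPrIntL_of_T8_recChi_k1aLegRowsDisplayChiAt_allL hT8 h2 hDisp)
    (HistoryTailOneSupplier.historyTailL_of_thm1In8_kinematicLift_dataRows_allL hT8 hkin hO)


/-- ★★★ **THE SAME WITH (R4) ASKED BELOW THE NEW LEVEL ONLY** (v1.1, append-only): the K1a input read as `K1aLegRowsDisplayChiAtLow` (p593261; (R4)'s new-level clause is `bound28`),
through `k1aLegRowsDisplayChiAt_of_low` and the `_displayAt` certificate above. [cite: Balaban1985Variational, Thm 1 (8) p.279, Prop. 8 p.304; Balaban1985UV3, (27)-(28) p.263, (43)-(47) pp.266-267; King1986, Thm 3.4 (3.9) p.656] -/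
theorem ym3TorusSU2_of_fiveInputs_displayAtLow
    (hH : ∀ (L : ℕ), 1 < L → ∃ B₃ : ℝ, 4 < B₃ ∧ ∃ a₅ : ℝ, 0 < a₅ ∧
      ∀ (i : Idx L) (ε₀ ε₁ : ℝ), 0 < ε₁ → ∀ (V : (famX L i).Bdry) (U : (famX L i).Cfg), (famX L i).Reg7 ε₁ V → (famX L i).InU ε₀ U →
        (famX L i).InB V U → (famX L i).IsCritical V U → ε₀ ≤ a₅ → (famX L i).InU (max (B₃ * ε₁) (ε₀ / 2)) U)
    (hEX : ∀ (L : ℕ), 1 < L → ∀ (B₃ : ℝ), 4 < B₃ → ∃ a₁' O₁ : ℝ, 0 < a₁' ∧ 1 ≤ O₁ ∧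
      ∀ (F : T3Family), F.L = L → ∀ (n K : ℕ) (hnK : n < K) (ε₁ : ℝ), 0 < ε₁ →
        ∀ V : GaugeField (F.P n) 0 (Matrix.specialUnitaryGroup (Fin 2) ℂ), PlaqSmall ε₁ V →
          ∀ U₀ : GaugeField (F.P K) 0 (Matrix.specialUnitaryGroup (Fin 2) ℂ), RegPr F n K ((L : ℝ) ^ 3 * B₃ * ε₁) U₀ → U₀ ∈ fibre F ℰp n K hnK.le V →
            ε₁ ≤ a₁' → ∃ U ∈ regFibrePr F n K hnK.le (O₁ * (L : ℝ) ^ 3 * B₃ * ε₁) V,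
              IsMinOn (fun W : GaugeField (F.P K) 0 (Matrix.specialUnitaryGroup (Fin 2) ℂ) => wilsonAction4 W)
                (regFibrePr F n K hnK.le (O₁ * (L : ℝ) ^ 3 * B₃ * ε₁) V) U)
    (hkin : ∀ L : ℕ, Odd L → 1 < L → ∃ (B_K η : ℝ), 0 < η ∧
      ∀ (F : T3Family) (_hF : F.L = L) (K : ℕ), ∀ (k : ℕ), k ≤ K → ∀ (Ω : Set (Site (F.P K) 0)), (∀ w : Site (F.P K) 0, w ∈ Ω ↔ toFine k (coarsen k w) ∈ Ω) →
        ∀ (ε : ℝ), 0 < ε → ε ≤ η → ∀ (W : GaugeField (F.P K) k (Matrix.specialUnitaryGroup (Fin 2) ℂ)), PlaqSmallOn (↑(plaqsIn k Ω)) ε W →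
          ∃ U : GaugeField (F.P K) 0 (Matrix.specialUnitaryGroup (Fin 2) ℂ),
            (∀ b : PBond (F.P K) k, b ∈ bondsIn k Ω → Averaging.iter (fun i => BlockAveraging.blockAvg (P := F.P K) (j := i) ℰp) k U b = W b) ∧
            ∀ q : Plaq (F.P K) 0, q ∈ plaqsIn 0 Ω → GaugeGroup.dist1 (GaugeField.plaqHol U q) < B_K * ε * (((F.L : ℝ) ^ k)⁻¹) ^ 2)
    (hO : ∀ L : ℕ, Odd L → 1 < L → ∃ (B₀ A₀ A₁ : ℝ), 0 < A₀ ∧ 0 < A₁ ∧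
      ∀ (B a₀ a₁ : ℝ), B₀ ≤ B → 1 ≤ 2 * B → 0 < a₀ → a₀ ≤ A₀ → 0 < a₁ → a₁ ≤ A₁ → B * a₁ ≤ a₀ →
        (143 * ((((3 + 4 : ℕ) : ℝ)) ^ 2 / 4) ^ 2) * (2 * (B * a₁)) ≤ 1 / 3 →
        2 * (2 * (B * a₁)) ≤ 2 * deltaSU (Fin 2) / (((3 + 4) * L : ℕ) : ℝ) ^ 2 →
        Thm1GlobalMinAt L a₀ a₁ B →
        ∃ (b₁ p₁ : ℝ), ∀ (b₀ p₀ : ℝ), b₁ ≤ b₀ → p₁ ≤ p₀ →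
          ∃ 𝔠 : AlphaConsts L (suGroupModel 2).N, 𝔠.b₀ = b₀ ∧ 𝔠.p₀ = p₀ ∧ 𝔠.B₃ = B ∧
            4 * 𝔠.B₃ * (L : ℝ) ^ 2 * avgWindowFactor L ≤ 𝔠.C68 ∧
            Real.exp (𝔠.p₀ - 1) ≤ 3 * C0 3 * 𝔠.C68 * (𝔠.b₀ * Q0 𝔠.p₀) ∧
            (𝔠.b₀ * Q0 𝔠.p₀) * (2 * (L : ℝ) ^ 2 * avgWindowFactor L) ^ 2 ≤ 3 * C0 3 * 𝔠.C68 * a₁ ^ 2 ∧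
            7 * L + 3 ≤ 𝔠.M₁ ∧
            ∀ (F : T3Family) (hF : F.L = L),
              (∀ (γ : ℝ) (hγ : 0 < γ) (hγ1 : γ ≤ (min (hF ▸ 𝔠).gamma0 1) ^ 2) (K : ℕ),
                (∃ Ut : (k : ℕ) → GaugeField (F.P K) k (Matrix.specialUnitaryGroup (Fin 2) ℂ) →
                    GaugeField (F.P K) 0 (Matrix.specialUnitaryGroup (Fin 2) ℂ),
                  AlphaInputsT3AC.TrivMinimiserRowsT3 F (hF ▸ 𝔠) γ hγ hγ1 a₀ a₁ K Ut) →
                ∃ Ut : (k : ℕ) → GaugeField (F.P K) k (Matrix.specialUnitaryGroup (Fin 2) ℂ) →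
                    GaugeField (F.P K) 0 (Matrix.specialUnitaryGroup (Fin 2) ℂ),
                  AlphaInputsT3AC.TrivMinimiserRowsT3 F (hF ▸ 𝔠) γ hγ hγ1 a₀ a₁ K Ut ∧
                    AlphaInputsT3AC.DataRowsT3XChi F (hF ▸ 𝔠) γ hγ hγ1 K Ut))
    (hDisp : ∀ (L : ℕ), Odd L → 1 < L → ∀ (𝔠 : AlphaConsts L (suGroupModel 2).N) (a₀ a₁ : ℝ), 0 < a₀ → 0 < a₁ → 𝔠.B₃ * a₁ ≤ a₀ →
      ∃ a : ℝ, 0 < a ∧ a < 1 ∧ ∃ p₁ : ℝ, 𝔠.p₀ + 𝔠.r₀ ≤ p₁ ∧ GlobalSlackKernelLeg.K1aLegRowsDisplayChiAtLow L 𝔠 a₀ a₁ a p₁) :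
    Literature.MathematicalPhysics.QuantumFieldTheory.Balaban1983to89.T3YM3TorusStatement.YM3TorusSU2 :=
  ym3TorusSU2_of_fiveInputs_displayAt hH hEX hkin hO fun L hLo hL 𝔠 a₀ a₁ ha0 ha1 hw => by
    obtain ⟨a, ha, ha1, p₁, hp₁, hD⟩ := hDisp L hLo hL 𝔠 a₀ a₁ ha0 ha1 hw
    exact ⟨a, ha, ha1, p₁, hp₁, GlobalSlackKernelLeg.k1aLegRowsDisplayChiAt_of_low hp₁ hD⟩

end Summit.QuantumFields.YangMills.Theorems.YM3OfFiveInputsProfile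

end
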